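import Literature.NumberTheory.GaloisCohomology.Howard2004.CofinalEmbeddingColimitProofs
import Literature.NumberTheory.GaloisCohomology.Howard2004.CofinalEmbeddingLimitProofs
import Literature.NumberTheory.GaloisCohomology.Howard2004.DVRSelmerATorsionControlProofs
import HarnessLib

/-!
# Howard 2004, Thm. 1.6.1: the conclusion TRANSFERS along a cofinal embedding of `DVRSetting`s
# (`Conclusion S' hy' one' → Conclusion S hy one`) — proofs file

Topic `NumberTheory/GaloisCohomology/Howard2004` (sequel to `CofinalEmbeddingColimitProofs` (C2: `H¹(K, A) ≃ H¹(K, A')`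
carrying `H¹_F(K, A)` onto `H¹_{F'}(K, A')`), `CofinalEmbeddingLimitProofs` (C1/C3: `IsFreeRankOneOn` and the length
clause descend) and `DVRSelmerATorsionControlProofs` (`DVRSetting.condA_eq`: under H.0–H.5 the propagated conditions
`condA F j` ARE the level conditions, Lemma 1.3.3)).  THEOREMS ONLY: no definition, no named fact, no instance, no
notation, no `sorry`.

WHY (INPUTS row G87 = `Howard2004.thm161_dvrKolyvaginBound` = Howard Thm. 1.6.1; stub `stub_h161` of the μ-crux
stmt-BirchSwinnertonDyer-22642, binder `h161` of crux 23055's print-leaf census; cell `pub/bsd-print-x9`, seat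
`bsd-line-x10b-p1-w7` g8; brick (COFINAL) of `bsd-line-x10b-p1` LEAD g11's note `HOME/p1/COFINAL-SPEC-x10b-p1-g11.md`).
Howard proves Thm. 1.6.1 on the FULL tower `T^{(k)} = T/𝔪^kT` (the `k`-induction of Lemma 1.6.4 uses a level of
every exponent, arXiv:1202.6340 p. 12 L3–7), whereas `h161` is APPLIED (in `HeegnerMuPartOfPrintKS.portCyclic_of_ks` /
`…portCyclic_anyClassNumber`) to gappy `DVRSetting`s (D1's Eisenstein towers, `e_k = m(k+1)`).  A kernel `thm161`
proved for full settings (via the refinement constructor (REFINE) of seat `bsd-line-x10b-p1-w2`) is consumed on the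
gappy setting `S` through THIS file:

* `DVRSetting.strictMono_idxSeq_of_e` — marked levels with `e' ∘ σ = e` increase strictly;
* **`DVRSetting.conclusion_of_cofinal`** — for `S : DVRSetting … N Rk Nbar Nq`, `S' : DVRSetting … N' Rk' Nbar' Nq'`
  over the same `R` with `hy`, `hy'` (H.0–H.5), `S'.π = S.π`, marked levels `σ = idxSeq s₀ d` with
  `S'.e (σ k) = S.e k`, level isomorphisms `ι k : N k →ₗ[R] N' (σ k)` presented as
  `hιq k : IsQuotientBy (S.T.ρ k) (I k) (S'.T.ρ (σ k)) (ι k)` with `ker (ι k) = 0`, RED-compatible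
  (`ι k ∘ red k = redIter' (σ k) (d k) ∘ ι (k+1)`), the level conditions at the marked levels propagated along `ι k`
  (`(hιq k).propagateStructure (S.t k).cond = (S'.t (σ k)).cond`), and bottom classes with
  `H¹(ι k) (one k) = one' (σ k)`, `one' ∈ lim`:  `S'.Conclusion hy' one' → S.Conclusion hy one`.
  Proof: `StrictMono σ` and cofinality from `e`/`e'`; C1 gives the generator `x` with `H¹(ι k)(x k) = x'(σ k)`; the same
  finite `M`; `Φ := (Ψ|_{H¹_F(K,A)} : H¹_F(K,A) ≃ H¹_{F'}(K,A')) ≫ Φ'` with `Ψ` from C2 (the propagated conditions being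
  the level conditions on both sides by `condA_eq`), `R`-equivariant on representatives since `H¹(ι k)` commutes with
  the scalars; the length clause by C3.

HONEST FRAMING: this is the CONSUMPTION step of a full-tower Thm. 1.6.1, not the theorem: `thm161_dvrKolyvaginBound`
is NOT proved (nor Lemma 1.6.4, nor (REFINE)); no summit statement is proved; the Birch–Swinnerton-Dyer conjecture is
not proved by any of this.
References: [Howard2004HeegnerKolyvagin] B. Howard, Compositio Math. 140 (2004), Thm. 1.6.1 and §1.6 (arXiv:1202.6340
Thm. 2.6.1, p. 11 L13–38, p. 12 L29–55), Lemma 1.3.3 (p. 7 L152–160); [SerreGaloisCohomology1997] I §2.2.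
-/

set_option autoImplicit false

noncomputable section

open Function NumberField IsDedekindDomain Field
open scoped NumberField ContRepresentation

namespace Literature.NumberTheory.GaloisCohomology.Howard2004

open Literature.NumberTheory.GaloisRepresentations
open Literature.NumberTheory.GaloisRepresentations.DiscreteGaloisModule
open Literature.NumberTheory.GaloisRepresentations.galoisCohomology

/-! ## The transfer `Conclusion S' hy' one' → Conclusion S hy one` -/

namespace DVRSetting

variable {p : ℕ} [Fact p.Prime] {K : Type} [Field K] [NumberField K]
  {R : Type} [CommRing R] [IsDomain R] [IsDiscreteValuationRing R] [Algebra ℤ_[p] R]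
  {N : ℕ → Type} [∀ k, AddCommGroup (N k)] [∀ k, TopologicalSpace (N k)] [∀ k, DiscreteTopology (N k)]
  [∀ k, Module R (N k)]
  {Rk : ℕ → Type} [∀ k, CommRing (Rk k)] [∀ k, IsLocalRing (Rk k)] [∀ k, TopologicalSpace (Rk k)]
  [∀ k, DiscreteTopology (Rk k)] [∀ k, Algebra ℤ_[p] (Rk k)] [∀ k, Algebra R (Rk k)]
  [∀ k, Module (Rk k) (N k)] [∀ k, IsScalarTower R (Rk k) (N k)]
  {Nbar : Type} [AddCommGroup Nbar] [TopologicalSpace Nbar] [DiscreteTopology Nbar] [∀ k, Module (Rk k) Nbar]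
  {Nq : ℕ → Finset (HeightOneSpectrum (𝓞 K)) → Type} [∀ k n, AddCommGroup (Nq k n)]
  [∀ k n, TopologicalSpace (Nq k n)] [∀ k n, DiscreteTopology (Nq k n)] [∀ k n, Module (Rk k) (Nq k n)]
  [∀ k n, Module R (Nq k n)] [∀ k n, IsScalarTower R (Rk k) (Nq k n)]
  {N' : ℕ → Type} [∀ k, AddCommGroup (N' k)] [∀ k, TopologicalSpace (N' k)] [∀ k, DiscreteTopology (N' k)]
  [∀ k, Module R (N' k)]
  {Rk' : ℕ → Type} [∀ k, CommRing (Rk' k)] [∀ k, IsLocalRing (Rk' k)] [∀ k, TopologicalSpace (Rk' k)]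
  [∀ k, DiscreteTopology (Rk' k)] [∀ k, Algebra ℤ_[p] (Rk' k)] [∀ k, Algebra R (Rk' k)]
  [∀ k, Module (Rk' k) (N' k)] [∀ k, IsScalarTower R (Rk' k) (N' k)]
  {Nbar' : Type} [AddCommGroup Nbar'] [TopologicalSpace Nbar'] [DiscreteTopology Nbar'] [∀ k, Module (Rk' k) Nbar']
  {Nq' : ℕ → Finset (HeightOneSpectrum (𝓞 K)) → Type} [∀ k n, AddCommGroup (Nq' k n)]
  [∀ k n, TopologicalSpace (Nq' k n)] [∀ k n, DiscreteTopology (Nq' k n)] [∀ k n, Module (Rk' k) (Nq' k n)]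
  [∀ k n, Module R (Nq' k n)] [∀ k n, IsScalarTower R (Rk' k) (Nq' k n)]

/-- The marked levels of a cofinal embedding with `e' ∘ σ = e` increase strictly (`e` strictly, `e'` monotonically).
[cite: Howard2004HeegnerKolyvagin, §1.6 (arXiv p. 11 L33–34, p. 12 L29)] -/
theorem strictMono_idxSeq_of_e (S : DVRSetting p K R N Rk Nbar Nq) (S' : DVRSetting p K R N' Rk' Nbar' Nq')
    (hy : S.SatisfiesH) (hy' : S'.SatisfiesH) (s₀ : ℕ) (d : ℕ → ℕ)
    (heσ : ∀ k, S'.e (idxSeq s₀ d k) = S.e k) : StrictMono (idxSeq s₀ d) := by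
  refine strictMono_nat_of_lt_succ fun k => ?_
  by_contra hlt
  have h1 : S'.e (idxSeq s₀ d (k + 1)) ≤ S'.e (idxSeq s₀ d k) := hy'.e_strictMono.monotone (not_lt.1 hlt)
  rw [heσ, heσ] at h1
  exact absurd h1 (not_le.2 (hy.e_strictMono (Nat.lt_succ_self k)))

/-- **The (COFINAL) transfer of the conclusion of Howard's Theorem 1.6.1 along a cofinal embedding of
`DVRSetting`s** `S ↪ S'` (marked levels `σ = idxSeq s₀ d` with `e' ∘ σ = e`, the same `R` and `π`, level
isomorphisms `ι_k : T_k ≅ T'_{σ k}` presented as `IsQuotientBy … (ι k)` with `ker ι_k = 0`, compatible with the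
reductions, the level conditions at the marked levels being the ones propagated along `ι_k`, and bottom classes with
`H¹(ι_k)(one k) = one' (σ k)`, `one' ∈ lim`): `S'.Conclusion hy' one' → S.Conclusion hy one` — with the SAME finite
module `M`, the generator restricted along the `ι_k`, and `H¹_F(K, A) ≃ H¹_{F'}(K, A')` by C2 (the propagated conditions
`condA` being the level conditions themselves on both sides by Lemma 1.3.3, `DVRSetting.condA_eq`).  This is the
consumption step for a full-tower `thm161` on a gappy tower (x10b-p1-w7 «LEVEL-GAP», LEAD g11 recommendation (β)).
[cite: Howard2004HeegnerKolyvagin, Thm. 1.6.1 and §1.6 (arXiv Thm. 2.6.1, p. 11 L23–38, p. 12 L29–55)] -/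
theorem conclusion_of_cofinal (S : DVRSetting p K R N Rk Nbar Nq) (S' : DVRSetting p K R N' Rk' Nbar' Nq')
    (hy : S.SatisfiesH) (hy' : S'.SatisfiesH) (hππ : S'.π = S.π)
    (s₀ : ℕ) (d : ℕ → ℕ) (heσ : ∀ k, S'.e (idxSeq s₀ d k) = S.e k)
    {I : ℕ → Ideal R} {ι : ∀ k, N k →ₗ[R] N' (idxSeq s₀ d k)}
    (hιq : ∀ k, IsQuotientBy (S.T.ρ k) (I k) (S'.T.ρ (idxSeq s₀ d k)) (ι k))
    (hιk : ∀ k, LinearMap.ker (ι k) = ⊥)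
    (hιred : ∀ k (y : N (k + 1)), ι k (S.T.red k y) = S'.T.redIter (idxSeq s₀ d k) (d k) (ι (k + 1) y))
    (hιF : ∀ k, (hιq k).propagateStructure ((S.t k).cond) = (S'.t (idxSeq s₀ d k)).cond)
    {one : ∀ k, galoisCohomology (S.T.ρ k) 1} {one' : ∀ j, galoisCohomology (S'.T.ρ j) 1}
    (hone' : one' ∈ S'.T.limitH1) (hιone : ∀ k, (hιq k).cohomologyMap 1 (one k) = one' (idxSeq s₀ d k))
    (h : S'.Conclusion hy' one') : S.Conclusion hy one := by
  -- derived letters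
  have hπ : S.π ∈ IsLocalRing.maximalIdeal R := by rw [hy.unif]; exact Ideal.mem_span_singleton_self _
  have he : ∀ k, S.e k ≤ S.e (k + 1) := fun k => (hy.e_strictMono (Nat.lt_succ_self k)).le
  have hπ' : S'.π ∈ IsLocalRing.maximalIdeal R := by rw [hy'.unif]; exact Ideal.mem_span_singleton_self _
  have he' : ∀ k, S'.e k ≤ S'.e (k + 1) := fun k => (hy'.e_strictMono (Nat.lt_succ_self k)).le
  have hσ : StrictMono (idxSeq s₀ d) := strictMono_idxSeq_of_e S S' hy hy' s₀ d heσ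
  have hcof : ∀ j, ∃ m, j ≤ idxSeq s₀ d m := fun j => ⟨j, hσ.id_le j⟩
  obtain ⟨g, hid, hcomp, hstep⟩ := AdicTower.exists_twoIndex_redH1 S'.T
  have hΦbij : ∀ k, Function.Bijective ((hιq k).cohomologyMap 1) := fun k =>
    (hιq k).bijective_cohomologyMap_of_ker_eq_bot (hιk k)
  have hΦsmul : ∀ (k : ℕ) (r : R) (c : galoisCohomology (S.T.ρ k) 1),
      (hιq k).cohomologyMap 1 (scalarMapH1 (S.T.ρ k) (S.T.hlin k) r c) =
        scalarMapH1 (S'.T.ρ (idxSeq s₀ d k)) (S'.T.hlin (idxSeq s₀ d k)) r ((hιq k).cohomologyMap 1 c) :=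
    AdicTower.cofinal_cohomologyMap_scalarMapH1 S.T S'.T s₀ d hιq
  have hΦred : ∀ (k : ℕ) (x : galoisCohomology (S.T.ρ (k + 1)) 1),
      (hιq k).cohomologyMap 1 (S.T.redH1 k x) =
        g (idxSeq s₀ d (k + 1)) (idxSeq s₀ d k) ((hιq (k + 1)).cohomologyMap 1 x) := fun k x =>
    (AdicTower.cofinal_cohomologyMap_redH1 S.T S'.T s₀ d hιq hιred k x).trans
      (AdicTower.twoIndex_eq_redIterH1 hid hcomp hstep (idxSeq s₀ d k) (d k) _).symm
  have hΦsel : ∀ (k : ℕ) (c : galoisCohomology (S.T.ρ k) 1),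
      (hιq k).cohomologyMap 1 c ∈ ((S'.t (idxSeq s₀ d k)).cond).selmerGroup ↔ c ∈ ((S.t k).cond).selmerGroup :=
    fun k c => (AdicTower.cofinal_mem_selmerGroup_iff S.T S'.T s₀ d hιq hιk (fun k => (S.t k).cond)
      (fun j => (S'.t j).cond) hιF k c).symm
  have hF'red : ∀ (i : ℕ) (w : galoisCohomology (S'.T.ρ (i + 1)) 1),
      w ∈ ((S'.t (i + 1)).cond).selmerGroup → S'.T.redH1 i w ∈ ((S'.t i).cond).selmerGroup :=
    fun i w hw => AdicTower.redH1_mem_selmerGroup_of_cond_red (fun j => (S'.t j).cond) hy'.cond_red i hw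
  -- unpack the conclusion on `S'`
  unfold DVRSetting.Conclusion at h ⊢
  obtain ⟨x', hx', M, instA, instM, instF, Φ', hΦ', hlen'⟩ := h
  have hx'1 : x' ∈ S'.T.limitH1 := ((S'.T.mem_limitSelmer_iff _ x').1 hx'.1).1
  -- C1
  obtain ⟨x, hx, hxx'⟩ := AdicTower.exists_isFreeRankOneOn_of_cofinal S.T S'.T (fun k => (S.t k).cond)
    (fun j => (S'.t j).cond) (idxSeq s₀ d) g (fun k => (hιq k).cohomologyMap 1) hσ hid hcomp hstep hF'red hΦbij
    hΦsmul hΦred hΦsel hx'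
  -- C2
  obtain ⟨Ψ, hΨ⟩ := AdicTower.exists_addEquiv_H1A_of_cofinal S.T S'.T S.π S'.π S.e S'.e hy.killed hy.ker_red hπ he
    hy'.killed hy'.ker_red hπ' he' s₀ d hιq hππ heσ hιk hιred hcof
  have hιA : ∀ k, (hιq k).propagateStructure
      (AdicTower.condA S.T S.π S.e hy.killed hy.ker_red hπ he (fun k => (S.t k).cond) k) =
      AdicTower.condA S'.T S'.π S'.e hy'.killed hy'.ker_red hπ' he' (fun j => (S'.t j).cond) (idxSeq s₀ d k) := by
    intro k
    rw [S.condA_eq hy hπ he k, S'.condA_eq hy' hπ' he']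
    exact hιF k
  have hΨ' : ∀ (k : ℕ) (c : galoisCohomology (S.T.ρ k) 1),
      (Ψ : _ →+ _) (AddCommGroup.DirectLimit.of (fun k => galoisCohomology (S.T.ρ k) 1)
        (AdicTower.incH1LE S.T S.π S.e hy.killed hy.ker_red hπ he) k c) =
        AddCommGroup.DirectLimit.of (fun j => galoisCohomology (S'.T.ρ j) 1)
          (AdicTower.incH1LE S'.T S'.π S'.e hy'.killed hy'.ker_red hπ' he') (idxSeq s₀ d k)
          ((hιq k).cohomologyMap 1 c) := fun k c => hΨ k c
  have hmap : (S.T.selmerA S.π S.e hy.killed hy.ker_red hπ he (fun k => (S.t k).cond)).map (Ψ : _ →+ _) =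
      S'.T.selmerA S'.π S'.e hy'.killed hy'.ker_red hπ' he' (fun j => (S'.t j).cond) := by
    refine le_antisymm (AdicTower.map_selmerA_le_of_cofinal S.T S'.T S.π S'.π S.e S'.e hy.killed hy.ker_red hπ he
      hy'.killed hy'.ker_red hπ' he' s₀ d hιq hιk _ _ hy.cond_red hy.cond_smul hy'.cond_red hy'.cond_smul hιA
      _ hΨ') fun b hb => ?_
    obtain ⟨a, ha, hab⟩ := AdicTower.exists_mem_selmerA_map_eq_of_cofinal S.T S'.T S.π S'.π S.e S'.e hy.killed
      hy.ker_red hπ he hy'.killed hy'.ker_red hπ' he' s₀ d hιq hιk hcof _ _ hy'.cond_red hy'.cond_smul hιA _ hΨ' hb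
    exact ⟨a, ha, hab⟩
  let Θ := (Ψ.addSubgroupMap (S.T.selmerA S.π S.e hy.killed hy.ker_red hπ he (fun k => (S.t k).cond))).trans
    (AddEquiv.addSubgroupCongr hmap)
  have hΘ : ∀ a, ((Θ a : ↥(S'.T.selmerA S'.π S'.e hy'.killed hy'.ker_red hπ' he' (fun j => (S'.t j).cond))) :
      AdicTower.H1A S'.T S'.π S'.e hy'.killed hy'.ker_red hπ' he') = Ψ a := fun a => by
    simp [Θ]
  refine ⟨x, hx, M, instA, instM, instF, Θ.trans Φ', fun j r c hc hrc => ?_, fun r₁ hr₁ => ?_⟩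
  · -- `R`-equivariance of `Φ' ∘ Θ` on representatives
    have hc' : AddCommGroup.DirectLimit.of (fun j => galoisCohomology (S'.T.ρ j) 1)
        (AdicTower.incH1LE S'.T S'.π S'.e hy'.killed hy'.ker_red hπ' he') (idxSeq s₀ d j)
        ((hιq j).cohomologyMap 1 c) ∈
        S'.T.selmerA S'.π S'.e hy'.killed hy'.ker_red hπ' he' (fun j => (S'.t j).cond) := by
      have h0 := AddSubgroup.mem_map_of_mem (Ψ : AdicTower.H1A S.T S.π S.e hy.killed hy.ker_red hπ he →+
        AdicTower.H1A S'.T S'.π S'.e hy'.killed hy'.ker_red hπ' he') hc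
      rw [hmap, hΨ'] at h0
      exact h0
    have hrc' : AddCommGroup.DirectLimit.of (fun j => galoisCohomology (S'.T.ρ j) 1)
        (AdicTower.incH1LE S'.T S'.π S'.e hy'.killed hy'.ker_red hπ' he') (idxSeq s₀ d j)
        (scalarMapH1 _ (S'.T.hlin (idxSeq s₀ d j)) r ((hιq j).cohomologyMap 1 c)) ∈
        S'.T.selmerA S'.π S'.e hy'.killed hy'.ker_red hπ' he' (fun j => (S'.t j).cond) := by
      have h0 := AddSubgroup.mem_map_of_mem (Ψ : AdicTower.H1A S.T S.π S.e hy.killed hy.ker_red hπ he →+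
        AdicTower.H1A S'.T S'.π S'.e hy'.killed hy'.ker_red hπ' he') hrc
      rw [hmap, hΨ', hΦsmul] at h0
      exact h0
    have e1 : Θ ⟨_, hc⟩ = ⟨_, hc'⟩ := Subtype.ext ((hΘ _).trans (hΨ j c))
    have e2 : Θ ⟨_, hrc⟩ = ⟨_, hrc'⟩ := Subtype.ext ((hΘ _).trans ((hΨ j _).trans (by rw [hΦsmul])))
    change Φ' (Θ ⟨_, hrc⟩) = r • Φ' (Θ ⟨_, hc⟩)
    rw [e1, e2]
    exact hΦ' (idxSeq s₀ d j) r ((hιq j).cohomologyMap 1 c) hc' hrc'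
  · -- the length clause: `one' = r₁ • x'`
    exact hlen' r₁ ((AdicTower.smulFamily_eq_iff_of_cofinal S.T S'.T (idxSeq s₀ d) g
      (fun k => (hιq k).cohomologyMap 1) hσ hid hcomp hstep hΦbij hΦsmul hone' (fun k => (hιone k).symm) hx'1
      hxx' r₁).1 hr₁)

/-! ## The marked index sequence of a `DVRSetting` inside its `π`-adic refinement -/

/-- **The marked levels of `S` in a full tower with exponents `i ↦ i + 1`**: with `s₀ := e_0 - 1` and
`d k := e_{k+1} - e_k`, `idxSeq s₀ d k + 1 = e_k` (uses `e_0 ≥ 1` and `e` strictly increasing) — the letter `heσ` of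
`conclusion_of_cofinal` for the `π`-adically refined setting (`S'.e = (· + 1)`), and the index identity
`i + 1 = S.e k` under which the refinement's marked-level facts are stated.
[cite: Howard2004HeegnerKolyvagin, §1.6 (arXiv p. 11 L33–36, p. 12 L29–33)] -/
theorem idxSeq_e_succ (S : DVRSetting p K R N Rk Nbar Nq) (hy : S.SatisfiesH) :
    ∀ k : ℕ, idxSeq (S.e 0 - 1) (fun k => S.e (k + 1) - S.e k) k + 1 = S.e k
  | 0 => by
    have h0 := hy.e_zero
    rw [idxSeq_zero]
    omega
  | k + 1 => by
    have ih := idxSeq_e_succ S hy k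
    have hlt : S.e k < S.e (k + 1) := hy.e_strictMono (Nat.lt_succ_self k)
    rw [idxSeq_succ]
    omega

/-- The same read as the letter `heσ`: `(fun i ↦ i + 1) (idxSeq (e_0 - 1) (fun k ↦ e_{k+1} - e_k) k) = e_k`.
[cite: Howard2004HeegnerKolyvagin, §1.6 (arXiv p. 11 L33–36, p. 12 L29–33)] -/
theorem succ_idxSeq_eq_e (S : DVRSetting p K R N Rk Nbar Nq) (hy : S.SatisfiesH) (k : ℕ) :
    (fun i : ℕ => i + 1) (idxSeq (S.e 0 - 1) (fun k => S.e (k + 1) - S.e k) k) = S.e k :=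
  S.idxSeq_e_succ hy k

end DVRSetting

end Literature.NumberTheory.GaloisCohomology.Howard2004

end
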